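import Mathlib.MeasureTheory.Measure.Haar.Unique
import Mathlib.Analysis.SpecificLimits.Normed
import Literature.NumberTheory.Automorphic.SphericalNotSquareIntegrableRankOne
import HarnessLib

/-!
# Square-integrability modulo the centre forces the decay `|λ|² < δ` of the ray coefficients
# `⟨φ, π(aᵐ)v⟩ = λᵐ φ(v)` of a `K`-fixed Hecke-ray eigenvector (Casselman 1995, Thm. 4.4.6 «⇒»; Harish-Chandra 1970 Part I §1)

Topic `NumberTheory/Automorphic`; namespace `Literature.NumberTheory.Automorphic.RayCoefficient`.  THEOREMS ONLY; no definition, no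
named fact, no instance, no notation, no `sorry`.  Cell `hodgecm-mathlib`, F0∕P3, road N5 (#109 `UnitaryGroup.U3SquareIntegrableExponents`
[Casselman1995, Thm. 4.4.6], rank one, no canonical pairing), file R4 «⇒»: the GENERIC analytic half of «square-integrable modulo the
centre ⇒ every exponent decays».  The structure theory of the group (Iwahori factorisation, Hecke ray operator `T_a = e_K π(a)`,
double-coset volumes, Cartan∕height separation) enters ONLY through explicit hypotheses, supplied on the road by the files R1
(`Representation.heckeRay`: `φ(π(aᵐ)v) = φ(T_aᵐ v)`), R3 (`μ_G(K aᵐ K) = μ_G(K)·δ_P(a)⁻ᵐ`, disjointness of the `K aᵐ K` by a height) and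
R2 (exponents of `π` ↔ eigenvalues of `T_a` on `V^K`).  HC_CM is proved only modulo the printed citations until rung 0 closes; this file
is unconditional and generic.

## The argument formalised [Casselman1995, proof of Thm. 4.4.6; HarishChandra1970, Part I §1 p. 4]
Let `ρ` be square-integrable modulo the centre (★ `Representation.IsSquareIntegrableModCenter`: every smooth coefficient is dominated by
the pull-back of an `L²(G⧸Z(G))` function), `K` compact open, `v ∈ V^K`, `φ ∈ Ṽ`
`K`-invariant with `φ(v) ≠ 0`, and suppose the RAY COEFFICIENTS are geometric, `φ(π(aᵐ) v) = λᵐ φ(v)` (for a `T_a`-eigenvector `v`,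
`T_a v = λ v`, this is R1's `φ(π(aᵐ)v) = φ(T_aᵐ v)`).  Then `|c_{φ,v}| = |λ|ᵐ |φ(v)|` on `K aᵐ K` (bi-`K`-invariance, ★
`SphericalCoefficient.matrixCoeff_eq_of_mem_doubleCoset`), so if the shells `(K aᵐ K)Z/Z ⊆ G⧸Z(G)` are pairwise disjoint, the `L²` majorant `f`
(read at a representative in `K aᵐ K` of each point of the shell) gives `Σ_m |λ|^{2m} |φ(v)|² μ((KaᵐK)Z/Z) ≤ ∫ f² < ∞` (§2, the
pointwise-on-shells form of ★ `SphericalCoefficient.summable_sq_mul_measureReal`); with the volume growth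
`μ((KaᵐK)Z/Z) ≥ c₀ rᵐ` this is a convergent geometric series of ratio `|λ|² r`, whence **`|λ|² r < 1`** (§2).  For `r = δ_P(a)⁻¹` and
`λ = χ(a)` the eigenvalue of `π_N(a)` this is Casselman's `|χ δ_P^{-1/2}(a)| < 1`.  §3 transfers the volume bound from `G` to `G⧸Z(G)`
when `Z(G)` is COMPACT (`U(3)`: `Z = E¹`): `map mk μ_G` is a Haar measure on `G⧸Z(G)` (`mk` is proper), so `μ(A Z/Z) ≥ s·μ_G(A)` for a
constant `s > 0` (uniqueness of Haar measure on sets with compact closure); §4 is the combined head with volumes in `G`.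

## What is formalised
* §1 `iterate_apply_eq_pow_smul`, `apply_pow_apply_eq_pow_mul` (eigenvector ⇒ geometric ray coefficients),
  `norm_matrixCoeff_eq_of_mem_doubleCoset` (`|c_{φ,v}| = |λ|ᵐ|φ v|` on `K aᵐ K`), `exists_invariant_form_apply_eq_one` (`Ṽ^K` separates `V^K`).
* §2 `summable_sq_mul_measureReal_of_le_on` (pure measure theory: `f ∈ L²`, `c_n ≤ f` on disjoint shells ⇒ `Σ c_n² μ(S_n) < ∞`),
  **`norm_sq_mul_lt_one`** (the criterion in `G⧸Z(G)`: `‖λ‖² r < 1`), `norm_sq_lt` (`r = d⁻¹`: `‖λ‖² < d`), `norm_mul_lt_one`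
  (`‖λ e‖ < 1` for `‖e‖² = d⁻¹`), **`norm_sq_lt_of_eigenvector`** (hypotheses in R1's shape: `T` homogeneous, `φ(π(aᵐ)v) = φ(T^[m] v)` for
  every `K`-invariant `φ`, `T v = λ v`).
* §3 `pairwise_disjoint_image_doubleCoset_of_height` (a bi-`K`-invariant, `Z(G)`-invariant height separating the `aᵐ` ⇒ disjoint shells),
  `isHaarMeasure_map_mk_of_isCompact_center`, **`exists_pos_forall_mul_le_measure_image_mk`** (`mk : G → G⧸Z(G)` is proper for compact `Z(G)`).
* §4 **`norm_sq_lt_of_eigenvector_of_isCompact_center`** (volumes `c₀ d⁻ᵐ ≤ μ_G(K aᵐ K)` in `G`, compact centre ⇒ `‖λ‖² < d`).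

## References
* [Casselman1995] W. Casselman, *Introduction to the theory of admissible representations of `p`-adic reductive groups* (draft 1 May
  1995), §4.1, Thm. 4.4.6 p. 45 (the case of `F`-rank one).
* [HarishChandra1970] Harish-Chandra, *Harmonic analysis on reductive `p`-adic groups* (notes by G. van Dijk), LNM 162 (1970), Part I §1 p. 4.
* [CartierCorvallis1979] P. Cartier, *Representations of `p`-adic groups: a survey*, Proc. Sympos. Pure Math. 33 (1979), Part 1, §IV.1.
* [DeitmarEchterhoff2014] A. Deitmar, S. Echterhoff, *Principles of Harmonic Analysis*, 2nd ed., Universitext (2014), §1.5, Thm. 1.5.3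
  (quotient integral formula; the invariant measure on `G/H` is unique up to a positive scalar).
-/

noncomputable section

open MeasureTheory Filter Topology
open scoped Pointwise NNReal ENNReal

namespace Literature.NumberTheory.Automorphic.RayCoefficient

/-! ## §1 Eigenvectors, geometric ray coefficients, and the coefficient on a double coset -/

section Algebra

variable {G V : Type*} [Group G] [AddCommGroup V] [Module ℂ V] {ρ : Representation ℂ G V} {K : Subgroup G}

/-- Iterates of a homogeneous map on an eigenvector: `T v = λ v ⇒ T^[m] v = λᵐ v` (for R1's Hecke ray operator `T_a`, a plain function,
homogeneity is its `heckeRay_smul`). [cite: Casselman1995, §4.1] -/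
theorem iterate_apply_eq_pow_smul {T : V → V} (hT : ∀ (c : ℂ) (w : V), T (c • w) = c • T w) {v : V} {lam : ℂ}
    (hv : T v = lam • v) (m : ℕ) : T^[m] v = lam ^ m • v := by
  induction m with
  | zero => rw [Function.iterate_zero, id, pow_zero, one_smul]
  | succ m ih => rw [Function.iterate_succ_apply', ih, hT, hv, smul_smul, pow_succ]

/-- **The ray coefficient of an eigenvector is geometric**: if `φ(π(aᵐ) v) = φ(T^[m] v)` (R1: `T = T_a = e_K π(a)` on `V^K`, `φ`
`K`-invariant) and `T v = λ v`, then `φ(π(aᵐ) v) = λᵐ φ(v)`. [cite: Casselman1995, §4.1] -/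
theorem apply_pow_apply_eq_pow_mul {T : V → V} (hT : ∀ (c : ℂ) (w : V), T (c • w) = c • T w) {a : G} {v : V}
    {φ : Module.Dual ℂ V} (hray : ∀ m : ℕ, φ (ρ (a ^ m) v) = φ (T^[m] v)) {lam : ℂ} (hv : T v = lam • v) (m : ℕ) :
    φ (ρ (a ^ m) v) = lam ^ m * φ v := by
  rw [hray m, iterate_apply_eq_pow_smul hT hv m, map_smul, smul_eq_mul]

/-- **The coefficient is constant in norm on the double coset**: for `v ∈ V^K`, `φ` `K`-invariant and geometric ray coefficients,
`‖c_{φ,v}(g)‖ = ‖λ‖ᵐ ‖φ v‖` for every `g ∈ K aᵐ K`. [cite: Casselman1995, Thm. 4.4.6] [cite: CartierCorvallis1979, §IV.1] -/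
theorem norm_matrixCoeff_eq_of_mem_doubleCoset {v : V} (hv : v ∈ ρ.fixedPoints K) {φ : Module.Dual ℂ V}
    (hφK : ∀ κ ∈ K, ∀ w : V, φ (ρ κ w) = φ w) {a : G} {lam : ℂ} (hcoef : ∀ m : ℕ, φ (ρ (a ^ m) v) = lam ^ m * φ v)
    {m : ℕ} {g : G} (hg : g ∈ DoubleCoset.doubleCoset (a ^ m) (K : Set G) K) :
    ‖ρ.matrixCoeff φ v g‖ = ‖lam‖ ^ m * ‖φ v‖ := by
  rw [SphericalCoefficient.matrixCoeff_eq_of_mem_doubleCoset hv hφK hg, Representation.matrixCoeff_apply, hcoef, norm_mul,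
    norm_pow]

variable [TopologicalSpace G] [IsTopologicalGroup G]

/-- **`Ṽ^K` separates `V^K`**: for a smooth `ρ`, `K` compact open and `v ∈ V^K`, `v ≠ 0`, there is a `K`-INVARIANT smooth linear form
`φ ∈ Ṽ` with `φ(v) = 1` (`φ = ℓ ∘ e_K` for any `ℓ` with `ℓ(v) = 1`, ★ `Representation.comp_avgProjLinear_mem_contragredient`; «`Ṽ^K = (V^K)^*`»).
[cite: Casselman1995, §2.1] [cite: CartierCorvallis1979, §IV.1 Cor. 4.1] -/
theorem exists_invariant_form_apply_eq_one (hρ : ρ.IsSmooth) (hKc : IsCompact (K : Set G)) (hKo : IsOpen (K : Set G))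
    {v : V} (hv : v ∈ ρ.fixedPoints K) (hv0 : v ≠ 0) :
    ∃ φ ∈ ρ.contragredient, φ v = 1 ∧ ∀ κ ∈ K, ∀ w : V, φ (ρ κ w) = φ w := by
  obtain ⟨ℓ, hℓ⟩ := Module.Projective.exists_dual_eq_one ℂ hv0
  refine ⟨ℓ.comp (ρ.avgProjLinear K hρ hKc), Representation.comp_avgProjLinear_mem_contragredient K hρ hKc hKo ℓ, ?_,
    fun κ hκ w => ?_⟩
  · rw [LinearMap.comp_apply, Representation.avgProjLinear_apply,
      Representation.avgProj_of_forall_apply_eq hKc hKo ((ρ.mem_fixedPoints K _).1 hv), hℓ]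
  · rw [LinearMap.comp_apply, LinearMap.comp_apply, Representation.avgProjLinear_apply, Representation.avgProjLinear_apply,
      Representation.avgProj_apply_of_mem hKc (hρ w) hκ]

end Algebra

/-! ## §2 The decay criterion in `G ⧸ Z(G)` -/

section Measure

variable {α : Type*} [MeasurableSpace α] {μ : Measure α}

/-- **An `L²` function bounded below by `c_n` ON pairwise disjoint shells `S_n` has `Σ c_n² μ(S_n) < ∞`** (`∑_{n<N} c_n² μ(S_n) ≤ ∫ f²`).
This is the measure-theoretic core of ★ `SphericalCoefficient.summable_sq_mul_measureReal`, with the lower bound asked only AT the points of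
`S_n` (not on whole fibres of `G → G⧸Z(G)`), which is what a coefficient dominated by `f ∘ mk` gives from ONE representative per point.
[cite: HarishChandra1970, Part I §1 p. 4] -/
theorem summable_sq_mul_measureReal_of_le_on {f : α → ℝ} (hf : MemLp f 2 μ) {S : ℕ → Set α} (hSm : ∀ n, MeasurableSet (S n))
    (hSfin : ∀ n, μ (S n) < ⊤) (hdisj : Pairwise (Function.onFun Disjoint S)) {c : ℕ → ℝ} (hc0 : ∀ n, 0 ≤ c n)
    (hc : ∀ n, ∀ x ∈ S n, c n ≤ f x) : Summable (fun n => c n ^ 2 * μ.real (S n)) := by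
  have hint : Integrable (fun x => f x ^ 2) μ := hf.integrable_sq
  have hcf : ∀ n, ∀ x ∈ S n, c n ^ 2 ≤ f x ^ 2 := fun n x hx => pow_le_pow_left₀ (hc0 n) (hc n x hx) 2
  refine summable_of_sum_range_le (c := ∫ x, f x ^ 2 ∂μ) (fun n => by positivity) fun N => ?_
  calc ∑ n ∈ Finset.range N, c n ^ 2 * μ.real (S n)
      = ∑ n ∈ Finset.range N, ∫ x in S n, c n ^ 2 ∂μ := by
        refine Finset.sum_congr rfl fun n _ => ?_
        rw [setIntegral_const, smul_eq_mul, mul_comm]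
    _ ≤ ∑ n ∈ Finset.range N, ∫ x in S n, f x ^ 2 ∂μ := by
        refine Finset.sum_le_sum fun n _ => ?_
        exact setIntegral_mono_on (integrableOn_const (hSfin n).ne) hint.integrableOn (hSm n) (hcf n)
    _ = ∫ x in ⋃ n ∈ Finset.range N, S n, f x ^ 2 ∂μ := by
        rw [integral_biUnion_finset _ (fun n _ => hSm n) (fun i _ j _ hij => hdisj hij) (fun n _ => hint.integrableOn)]
    _ ≤ ∫ x, f x ^ 2 ∂μ := setIntegral_le_integral hint (Eventually.of_forall fun x => sq_nonneg (f x))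

end Measure

section Quotient

variable {G V : Type*} [Group G] [TopologicalSpace G] [IsTopologicalGroup G] [AddCommGroup V] [Module ℂ V]
  [MeasurableSpace (G ⧸ Subgroup.center G)] [BorelSpace (G ⧸ Subgroup.center G)]
  {ρ : Representation ℂ G V} {K : Subgroup G} {μ : Measure (G ⧸ Subgroup.center G)}

/-- **Square-integrability modulo the centre forces `‖λ‖² r < 1`.**  Let `ρ` be square-integrable modulo the centre w.r.t. a measure
`μ` on `G ⧸ Z(G)` finite on compact sets (★ `Representation.IsSquareIntegrableModCenter`), `K` compact open, `v ∈ V^K`,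
`φ ∈ Ṽ` `K`-invariant with `φ(v) ≠ 0`, and let the ray coefficients be geometric, `φ(π(aᵐ) v) = λᵐ φ(v)`.
If the shells `(K aᵐ K)Z/Z` (`m ∈ ℕ`) are pairwise disjoint and `μ((K aᵐ K)Z/Z) ≥ c₀ rᵐ` with `c₀ > 0`, `r ≥ 0`, then `‖λ‖² · r < 1`:
`Σ_m |λ|^{2m}|φ v|² μ((KaᵐK)Z/Z) < ∞` (`summable_sq_mul_measureReal_of_le_on`, the `L²` majorant read at a representative in `K aᵐ K` of each point
of the shell — no central-character hypothesis is needed), and it dominates the geometric series of ratio `‖λ‖² r`. [cite: Casselman1995, Thm. 4.4.6] [cite: HarishChandra1970, Part I §1 p. 4] -/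
theorem norm_sq_mul_lt_one [IsFiniteMeasureOnCompacts μ] (h : ρ.IsSquareIntegrableModCenter μ)
    (hKo : IsOpen (K : Set G)) (hKc : IsCompact (K : Set G)) {v : V} (hv : v ∈ ρ.fixedPoints K)
    {φ : Module.Dual ℂ V} (hφ : φ ∈ ρ.contragredient) (hφK : ∀ κ ∈ K, ∀ w : V, φ (ρ κ w) = φ w) (hφv : φ v ≠ 0)
    {a : G} {lam : ℂ} (hcoef : ∀ m : ℕ, φ (ρ (a ^ m) v) = lam ^ m * φ v)
    (hdisj : Pairwise (Function.onFun Disjoint fun m : ℕ =>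
      (QuotientGroup.mk : G → G ⧸ Subgroup.center G) '' DoubleCoset.doubleCoset (a ^ m) (K : Set G) K))
    {c₀ r : ℝ} (hc₀ : 0 < c₀) (hr : 0 ≤ r)
    (hvol : ∀ m : ℕ, c₀ * r ^ m ≤
      μ.real ((QuotientGroup.mk : G → G ⧸ Subgroup.center G) '' DoubleCoset.doubleCoset (a ^ m) (K : Set G) K)) :
    ‖lam‖ ^ 2 * r < 1 := by
  set S : ℕ → Set (G ⧸ Subgroup.center G) := fun m =>
    (QuotientGroup.mk : G → G ⧸ Subgroup.center G) '' DoubleCoset.doubleCoset (a ^ m) (K : Set G) K with hS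
  have hSm : ∀ m, MeasurableSet (S m) := fun m => (SphericalCoefficient.isOpen_image_doubleCoset hKo _).measurableSet
  have hSfin : ∀ m, μ (S m) < ⊤ := fun m => (SphericalCoefficient.isCompact_image_doubleCoset hKc _).measure_lt_top
  -- the `L²` majorant is `≥ ‖λ‖ᵐ ‖φ v‖` at every point of the shell (read at a representative in `K aᵐ K`)
  obtain ⟨f, hf2, hdom⟩ := h φ hφ v
  have hc : ∀ m, ∀ x ∈ S m, ‖lam‖ ^ m * ‖φ v‖ ≤ f x := by
    rintro m _ ⟨g, hg, rfl⟩
    rw [← norm_matrixCoeff_eq_of_mem_doubleCoset hv hφK hcoef hg]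
    exact hdom g
  have hsum := summable_sq_mul_measureReal_of_le_on hf2 hSm hSfin hdisj (c := fun m => ‖lam‖ ^ m * ‖φ v‖)
    (fun m => by positivity) hc
  -- comparison with the geometric series of ratio `‖λ‖² r`
  have hφv' : 0 < ‖φ v‖ ^ 2 * c₀ := mul_pos (pow_pos (norm_pos_iff.2 hφv) 2) hc₀
  have hgeom : Summable fun m : ℕ => ‖φ v‖ ^ 2 * c₀ * (‖lam‖ ^ 2 * r) ^ m := by
    refine Summable.of_nonneg_of_le (fun m => by positivity) (fun m => ?_) hsum
    calc ‖φ v‖ ^ 2 * c₀ * (‖lam‖ ^ 2 * r) ^ m = (‖lam‖ ^ m * ‖φ v‖) ^ 2 * (c₀ * r ^ m) := by ring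
      _ ≤ (‖lam‖ ^ m * ‖φ v‖) ^ 2 * μ.real (S m) := mul_le_mul_of_nonneg_left (hvol m) (sq_nonneg _)
  rw [summable_mul_left_iff hφv'.ne'] at hgeom
  have := summable_geometric_iff_norm_lt_one.1 hgeom
  rwa [Real.norm_of_nonneg (by positivity)] at this

/-- **`‖λ‖² < d`** — the form with `r = d⁻¹`: shells of volume `≥ c₀ d⁻ᵐ` (R3: `c₀ = μ_G(K)`·const, `d = δ_P(a)`).
[cite: Casselman1995, Thm. 4.4.6] -/
theorem norm_sq_lt [IsFiniteMeasureOnCompacts μ] (h : ρ.IsSquareIntegrableModCenter μ)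
    (hKo : IsOpen (K : Set G)) (hKc : IsCompact (K : Set G)) {v : V} (hv : v ∈ ρ.fixedPoints K)
    {φ : Module.Dual ℂ V} (hφ : φ ∈ ρ.contragredient) (hφK : ∀ κ ∈ K, ∀ w : V, φ (ρ κ w) = φ w) (hφv : φ v ≠ 0)
    {a : G} {lam : ℂ} (hcoef : ∀ m : ℕ, φ (ρ (a ^ m) v) = lam ^ m * φ v)
    (hdisj : Pairwise (Function.onFun Disjoint fun m : ℕ =>
      (QuotientGroup.mk : G → G ⧸ Subgroup.center G) '' DoubleCoset.doubleCoset (a ^ m) (K : Set G) K))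
    {c₀ d : ℝ} (hc₀ : 0 < c₀) (hd : 0 < d)
    (hvol : ∀ m : ℕ, c₀ * d⁻¹ ^ m ≤
      μ.real ((QuotientGroup.mk : G → G ⧸ Subgroup.center G) '' DoubleCoset.doubleCoset (a ^ m) (K : Set G) K)) :
    ‖lam‖ ^ 2 < d := by
  have := norm_sq_mul_lt_one h hKo hKc hv hφ hφK hφv hcoef hdisj hc₀ (inv_nonneg.2 hd.le) hvol
  rwa [mul_inv_lt_iff₀ hd, one_mul] at this

/-- **Consumer form `‖λ · e‖ < 1`** for any scalar `e` with `‖e‖² = d⁻¹` (on the road: `e = δ_P(a)^{-1/2}`, `λ e = χ′(a)` the value of the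
NORMALISED exponent, so `‖χ′(a)‖ < 1`). [cite: Casselman1995, Thm. 4.4.6] -/
theorem norm_mul_lt_one_of_norm_sq_lt {lam e : ℂ} {d : ℝ} (hd : 0 < d) (h : ‖lam‖ ^ 2 < d) (he : ‖e‖ ^ 2 = d⁻¹) :
    ‖lam * e‖ < 1 := by
  have h2 : ‖lam * e‖ ^ 2 < 1 := by
    rw [norm_mul, mul_pow, he, mul_inv_lt_iff₀ hd, one_mul]
    exact h
  exact (pow_lt_one_iff_of_nonneg (norm_nonneg _) two_ne_zero).1 h2

/-- **Square-integrability ⇒ eigenvalue decay, eigenvector form (the head R4's assembler calls).**  Let `ρ` be SMOOTH and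
square-integrable modulo the centre w.r.t. `μ` (finite on compacts), `K` compact open, `T : V → V` homogeneous with
`φ(π(aᵐ) w) = φ(T^[m] w)` for every `K`-invariant linear form `φ` and the given `v ∈ V^K` (R1 with `T = T_a`), `v ≠ 0` a `T`-eigenvector,
`T v = λ v`; if the shells `(KaᵐK)Z/Z` are pairwise disjoint of volume `≥ c₀ d⁻ᵐ`
(`c₀, d > 0`), then `‖λ‖² < d`. [cite: Casselman1995, Thm. 4.4.6] [cite: HarishChandra1970, Part I §1 p. 4] -/
theorem norm_sq_lt_of_eigenvector [IsFiniteMeasureOnCompacts μ] (hρ : ρ.IsSmooth) (h : ρ.IsSquareIntegrableModCenter μ)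
    (hKo : IsOpen (K : Set G)) (hKc : IsCompact (K : Set G)) {T : V → V} (hT : ∀ (c : ℂ) (w : V), T (c • w) = c • T w)
    {a : G} {v : V} (hv : v ∈ ρ.fixedPoints K) (hv0 : v ≠ 0)
    (hray : ∀ φ : Module.Dual ℂ V, (∀ κ ∈ K, ∀ x : V, φ (ρ κ x) = φ x) → ∀ m : ℕ, φ (ρ (a ^ m) v) = φ (T^[m] v))
    {lam : ℂ} (hTv : T v = lam • v)
    (hdisj : Pairwise (Function.onFun Disjoint fun m : ℕ =>
      (QuotientGroup.mk : G → G ⧸ Subgroup.center G) '' DoubleCoset.doubleCoset (a ^ m) (K : Set G) K))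
    {c₀ d : ℝ} (hc₀ : 0 < c₀) (hd : 0 < d)
    (hvol : ∀ m : ℕ, c₀ * d⁻¹ ^ m ≤
      μ.real ((QuotientGroup.mk : G → G ⧸ Subgroup.center G) '' DoubleCoset.doubleCoset (a ^ m) (K : Set G) K)) :
    ‖lam‖ ^ 2 < d := by
  obtain ⟨φ, hφ, hφ1, hφK⟩ := exists_invariant_form_apply_eq_one hρ hKc hKo hv hv0
  have hφv : φ v ≠ 0 := by rw [hφ1]; exact one_ne_zero
  exact norm_sq_lt h hKo hKc hv hφ hφK hφv (apply_pow_apply_eq_pow_mul hT (hray φ hφK) hTv) hdisj hc₀ hd hvol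

end Quotient

/-! ## §3 Interfaces for the structure-theoretic inputs: disjointness by a height; volumes for a compact centre -/

section Height

variable {G : Type*} [Group G] {K : Subgroup G}

/-- **Disjointness of the shells by a height.**  If `h : G → ι` is bi-`K`-invariant and `Z(G)`-invariant and separates the powers `aᵐ`,
then the shells `(K aᵐ K)Z/Z ⊆ G ⧸ Z(G)` are pairwise disjoint (R3's «disjointness by a height», e.g. the valuation of a matrix entry).
[cite: Casselman1995, Thm. 4.4.6] [cite: CartierCorvallis1979, §IV.1] -/
theorem pairwise_disjoint_image_doubleCoset_of_height {ι : Type*} (h : G → ι)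
    (hK : ∀ κ₁ ∈ K, ∀ κ₂ ∈ K, ∀ g : G, h (κ₁ * g * κ₂) = h g) (hZ : ∀ z ∈ Subgroup.center G, ∀ g : G, h (g * z) = h g)
    {a : G} (hinj : Function.Injective fun m : ℕ => h (a ^ m)) :
    Pairwise (Function.onFun Disjoint fun m : ℕ =>
      (QuotientGroup.mk : G → G ⧸ Subgroup.center G) '' DoubleCoset.doubleCoset (a ^ m) (K : Set G) K) := by
  intro m m' hne
  rw [Function.onFun, Set.disjoint_left]
  rintro _ ⟨g₁, hg₁, rfl⟩ ⟨g₂, hg₂, hgg⟩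
  apply hne
  apply hinj
  have hz : g₂⁻¹ * g₁ ∈ Subgroup.center G := QuotientGroup.eq.1 hgg
  obtain ⟨κ₁, hκ₁, κ₂, hκ₂, rfl⟩ := DoubleCoset.mem_doubleCoset.1 hg₁
  obtain ⟨κ₃, hκ₃, κ₄, hκ₄, rfl⟩ := DoubleCoset.mem_doubleCoset.1 hg₂
  have h1 : h (κ₁ * a ^ m * κ₂) = h (a ^ m) := hK κ₁ hκ₁ κ₂ hκ₂ _
  have h2 : h (κ₃ * a ^ m' * κ₄) = h (a ^ m') := hK κ₃ hκ₃ κ₄ hκ₄ _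
  have h3 : h (κ₃ * a ^ m' * κ₄ * ((κ₃ * a ^ m' * κ₄)⁻¹ * (κ₁ * a ^ m * κ₂))) = h (κ₃ * a ^ m' * κ₄) := hZ _ hz _
  rw [mul_inv_cancel_left] at h3
  change h (a ^ m) = h (a ^ m')
  rw [← h1, ← h2, h3]

end Height

section Transfer

variable {G : Type*} [Group G] [TopologicalSpace G] [IsTopologicalGroup G]

/-- The quotient map `G → G ⧸ Z(G)` is PROPER when the centre is compact (closed map with compact fibres `g Z(G)`; private bookkeeping for
the next theorem). [folklore] -/
private theorem isProperMap_mk_of_isCompact_center (hZ : IsCompact (Subgroup.center G : Set G)) :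
    IsProperMap (QuotientGroup.mk : G → G ⧸ Subgroup.center G) := by
  rw [isProperMap_iff_isClosedMap_and_compact_fibers]
  refine ⟨QuotientGroup.continuous_mk, QuotientGroup.isClosedMap_coe hZ, fun y => ?_⟩
  obtain ⟨g, rfl⟩ := QuotientGroup.mk_surjective y
  rw [← Set.image_singleton, QuotientGroup.preimage_image_mk_eq_mul]
  exact isCompact_singleton.mul hZ

variable [MeasurableSpace G] [BorelSpace G] [MeasurableSpace (G ⧸ Subgroup.center G)] [BorelSpace (G ⧸ Subgroup.center G)]

/-- For a compact centre, the image `map mk μ_G` of a Haar measure of `G` is a Haar measure on `G ⧸ Z(G)` — the quotient measure of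
[DeitmarEchterhoff2014, Thm. 1.5.3] for the compact normal subgroup `H = Z(G)` with `μ_H` of mass one (`∫_G f = ∫_{G/H} ∫_H f(xh) dh dx`;
here: Mathlib `isHaarMeasure_map` for the proper surjection `mk`). [cite: DeitmarEchterhoff2014, Thm. 1.5.3] -/
theorem isHaarMeasure_map_mk_of_isCompact_center (hZ : IsCompact (Subgroup.center G : Set G)) (μG : Measure G)
    [μG.IsHaarMeasure] : (μG.map (QuotientGroup.mk : G → G ⧸ Subgroup.center G)).IsHaarMeasure := by
  have hprop := isProperMap_mk_of_isCompact_center hZ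
  refine Measure.isHaarMeasure_map μG (QuotientGroup.mk' (Subgroup.center G)) QuotientGroup.continuous_mk
    QuotientGroup.mk_surjective ?_
  rw [hasBasis_cocompact.tendsto_right_iff]
  intro C hC
  exact (hprop.isCompact_preimage hC).compl_mem_cocompact

/-- **Volumes in `G ⧸ Z(G)` from volumes in `G` (compact centre).**  If `Z(G)` is compact, `μ_G` is a Haar measure on `G` and `μ` a Haar
measure on `G ⧸ Z(G)`, there is `s > 0` with `μ(A Z/Z) ≥ s · μ_G(A)` for every `A ⊆ G` with compact closure (`s` = the Haar scalar factor
of `μ` against `map mk μ_G` — uniqueness of the invariant measure on `G/H` up to a positive scalar, [DeitmarEchterhoff2014, Thm. 1.5.3] — and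
`A ⊆ mk⁻¹(mk(A)) = A·Z(G)`). [cite: DeitmarEchterhoff2014, Thm. 1.5.3] -/
theorem exists_pos_forall_mul_le_measure_image_mk [LocallyCompactSpace G] (hZ : IsCompact (Subgroup.center G : Set G))
    (μG : Measure G) [μG.IsHaarMeasure] (μ : Measure (G ⧸ Subgroup.center G)) [μ.IsHaarMeasure] :
    ∃ s : ℝ≥0, 0 < s ∧ ∀ A : Set G, IsCompact (closure A) →
      (s : ℝ≥0∞) * μG A ≤ μ ((QuotientGroup.mk : G → G ⧸ Subgroup.center G) '' A) := by
  haveI := isHaarMeasure_map_mk_of_isCompact_center hZ μG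
  refine ⟨Measure.haarScalarFactor μ (μG.map (QuotientGroup.mk : G → G ⧸ Subgroup.center G)),
    Measure.haarScalarFactor_pos_of_isHaarMeasure _ _, fun A hA => ?_⟩
  have hcl : IsCompact (closure ((QuotientGroup.mk : G → G ⧸ Subgroup.center G) '' A)) :=
    (hA.image QuotientGroup.continuous_mk).closure_of_subset (Set.image_mono subset_closure)
  rw [Measure.measure_isMulInvariant_eq_smul_of_isCompact_closure μ (μG.map (QuotientGroup.mk : G → G ⧸ Subgroup.center G)) hcl,
    ENNReal.smul_def, smul_eq_mul]
  exact mul_le_mul_right ((measure_mono (Set.subset_preimage_image _ A)).trans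
    (Measure.le_map_apply QuotientGroup.continuous_mk.aemeasurable _)) _

end Transfer

/-! ## §4 The combined head: volumes in `G`, compact centre -/

section Combined

variable {G V : Type*} [Group G] [TopologicalSpace G] [IsTopologicalGroup G] [LocallyCompactSpace G]
  [MeasurableSpace G] [BorelSpace G] [AddCommGroup V] [Module ℂ V]
  [MeasurableSpace (G ⧸ Subgroup.center G)] [BorelSpace (G ⧸ Subgroup.center G)]
  {ρ : Representation ℂ G V} {K : Subgroup G} {μ : Measure (G ⧸ Subgroup.center G)}

/-- **Square-integrability modulo a COMPACT centre ⇒ eigenvalue decay, volumes read in `G`.**  As `norm_sq_lt_of_eigenvector`, with the shell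
volumes supplied in `G`: `c₀ d⁻ᵐ ≤ μ_G(K aᵐ K)` for a Haar measure `μ_G` (R3: `μ_G(KaᵐK) = #(KaᵐK∕K)·μ_G(K)` by ★
`measure_doubleCoset_eq_ncard_mul`, `#(KaᵐK∕K) ≥ [K∩N : aᵐ(K∩N)a⁻ᵐ] = δ_P(a)⁻ᵐ` by ★ `DoubleCosetIndex.relIndex_conj_le_of_contracts` + R3b; so `c₀ = μ_G(K)`,
`d = δ_P(a)`), `μ` a Haar measure on `G ⧸ Z(G)`, `Z(G)` compact (`U(3)`: `Z = E¹`).  Conclusion `‖λ‖² < d`; with R2's dictionary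
`λ = χ′(a)·δ_P(a)^{1/2}` (`χ′` a normalised exponent) this is Casselman's `‖χ′(a)‖ < 1` (`norm_mul_lt_one_of_norm_sq_lt`).
[cite: Casselman1995, Thm. 4.4.6] [cite: HarishChandra1970, Part I §1 p. 4] -/
theorem norm_sq_lt_of_eigenvector_of_isCompact_center (hZ : IsCompact (Subgroup.center G : Set G))
    (μG : Measure G) [μG.IsHaarMeasure] [μ.IsHaarMeasure] (hρ : ρ.IsSmooth) (h : ρ.IsSquareIntegrableModCenter μ)
    (hKo : IsOpen (K : Set G)) (hKc : IsCompact (K : Set G)) {T : V → V} (hT : ∀ (c : ℂ) (w : V), T (c • w) = c • T w)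
    {a : G} {v : V} (hv : v ∈ ρ.fixedPoints K) (hv0 : v ≠ 0)
    (hray : ∀ φ : Module.Dual ℂ V, (∀ κ ∈ K, ∀ x : V, φ (ρ κ x) = φ x) → ∀ m : ℕ, φ (ρ (a ^ m) v) = φ (T^[m] v))
    {lam : ℂ} (hTv : T v = lam • v)
    (hdisj : Pairwise (Function.onFun Disjoint fun m : ℕ =>
      (QuotientGroup.mk : G → G ⧸ Subgroup.center G) '' DoubleCoset.doubleCoset (a ^ m) (K : Set G) K))
    {c₀ d : ℝ} (hc₀ : 0 < c₀) (hd : 0 < d)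
    (hvolG : ∀ m : ℕ, c₀ * d⁻¹ ^ m ≤ μG.real (DoubleCoset.doubleCoset (a ^ m) (K : Set G) K)) :
    ‖lam‖ ^ 2 < d := by
  obtain ⟨s, hs, hle⟩ := exists_pos_forall_mul_le_measure_image_mk hZ μG μ
  refine norm_sq_lt_of_eigenvector hρ h hKo hKc hT hv hv0 hray hTv hdisj (mul_pos (NNReal.coe_pos.2 hs) hc₀) hd fun m => ?_
  have hDc : IsCompact (DoubleCoset.doubleCoset (a ^ m) (K : Set G) K) := (hKc.mul isCompact_singleton).mul hKc
  have hfin : μ ((QuotientGroup.mk : G → G ⧸ Subgroup.center G) '' DoubleCoset.doubleCoset (a ^ m) (K : Set G) K) ≠ ⊤ :=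
    (SphericalCoefficient.isCompact_image_doubleCoset hKc _).measure_lt_top.ne
  have h1 := ENNReal.toReal_mono hfin (hle _ hDc.closure)
  rw [ENNReal.toReal_mul, ENNReal.coe_toReal] at h1
  calc (s : ℝ) * c₀ * d⁻¹ ^ m = s * (c₀ * d⁻¹ ^ m) := by ring
    _ ≤ s * μG.real (DoubleCoset.doubleCoset (a ^ m) (K : Set G) K) := mul_le_mul_of_nonneg_left (hvolG m) s.2
    _ ≤ μ.real ((QuotientGroup.mk : G → G ⧸ Subgroup.center G) '' DoubleCoset.doubleCoset (a ^ m) (K : Set G) K) := h1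

end Combined

end Literature.NumberTheory.Automorphic.RayCoefficient

end
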